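import Mathlib
import HarnessLib
import Summits.Ventures.LatticeQCDFlow.Scaling.AutoregressiveGaugeHeatBathRanked
import Summits.Ventures.LatticeQCDFlow.Scoring.FlowSamplerAutocorrelation
import Summits.Ventures.LatticeQCDFlow.Scoring.NonabelianAreaLaw2DWilsonLoop
import Summits.Ventures.LatticeQCDFlow.Exactness.FlowSamplerOperator

/-!
# LatticeQCDFlow / Scaling — plaquette-block proposals in EVERY dimension: the exact independence
# Metropolis sampler with proposal `(F_B/Z_B)·Haar` has acceptance `≥ (m/M)^k` pointwise and
# `τ_int ≤ (M/m)^k − 1/2`, `k` = the number of plaquettes outside `B`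

HONEST FRAMING: exact (Metropolis-corrected) sampling algorithms for lattice gauge theory;
figures of merit are autocorrelation/cost numbers at stated couplings and volumes; no
continuum-physics claim.

Venture `LatticeQCDFlow` (cell pub-lqcd), topic `Scaling`, FANOUT row 30 (lean-1, GEN-24) — OUR WORK on
THEORY-2.md §4 row C5.  `Scaling/AutoregressiveGaugeHeatBathTorusTauInt` (PL2) proved the Doeblin law for
the two-dimensional periodic target in the base-site language; this file states it for the plaquette
product weight `F = ∏_{p : Plaquette d L} w(U_p)` of `(ℤ/L)^d` in EVERY dimension `d` and for EVERY set
`B` of plaquettes (`k = #Bᶜ`, `F_B = ∏_{p∈B} w(U_p)`, `F_R = ∏_{p∉B} w(U_p)`, `w` continuous with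
`0 < m ≤ w ≤ M`):

* §1 `continuous_prodPlaquetteWeight_anyDim`, `pow_le_prodPlaquetteWeight_le_pow_anyDim`,
  `isProbabilityMeasure_haarPi_withDensity_div_integral_anyDim` (bookkeeping);
* §2 **`plaquetteBlockProposal_autocorrelation`** — with `π = (F/Z)·Haar^{⊗E}`, `q = (F_B/Z_B)·Haar^{⊗E}`
  and `ρ = Z/(Z_B·F_R)` (`q = ρ·π`, `ρ(U) ≤ (M/m)^k ρ(V)`): the exact independence Metropolis kernel
  `indepMH q (1/ρ)` has `|C_f(t)| ≤ (1 − (m/M)^k)^t ∫f² dπ` and `τ_int(f) ≤ (M/m)^k − 1/2` for every bounded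
  measurable `π`-centred `f` (row 8's `indepMH_autocorrelation_of_density_ratio`);
* §3 **`plaquetteBlockProposal_imhAcceptQ_ge`** — the Metropolis–Hastings acceptance of the proposal
  density `F_B/Z_B` against `F` is `≥ (m/M)^k` for EVERY state and proposal (the ratio collapses to
  `F_R(V)/F_R(U)`); **`ranked_imhAcceptQ_ge`** — the same with the heat-bath autoregressive hybrid `H_l`
  of a RANKED `B` in place of `F_B/Z_B` (they coincide pointwise, `ranked_arHybrid_eq_target`).

With `Scaling/AutoregressiveGaugeHeatBathRanked` / `…Comb` (the proposal is exactly samplable iff-style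
datum: `B` ranked) and `Scaling/AutoregressiveGaugeHeatBathDimensionGap` (`k = 1` attainable in `d = 2`,
`k ≥ #plaquettes/6` forced in `d ≥ 3`) this is the complete scorecard of one-plaquette heat-bath
autoregression as an exact-sampler proposal.  No `def`, no `sorry`, nothing cited as a fact.
-/

noncomputable section

namespace Summit.Ventures.LatticeQCDFlow.Theory2.Autoregressive

open MeasureTheory ProbabilityTheory Function Finset
open Literature.MathematicalPhysics.QuantumFieldTheory Literature.MathematicalPhysics.QuantumLattice
open Summit.Ventures.LatticeQCDFlow.Exactness Summit.Ventures.LatticeQCDFlow.Scoring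
open Summit.Ventures.LatticeQCDFlow.Theory2.Lattice Summit.Ventures.LatticeQCDFlow.Theory2.Lattice.TwoDim
open scoped ENNReal

variable {d L : ℕ} [NeZero L] {G : Type*} [Group G] [TopologicalSpace G] [IsTopologicalGroup G]
  [CompactSpace G] [SecondCountableTopology G] [MeasurableSpace G] [BorelSpace G]

/-! ## §1 Bookkeeping -/

omit [NeZero L] [CompactSpace G] [SecondCountableTopology G] [MeasurableSpace G] [BorelSpace G] in
/-- A product of plaquette weights over any set of base sites is a continuous function of the
configuration. [folklore] -/
theorem continuous_prodPlaquetteWeight_anyDim {w : G → ℝ} (hw : Continuous w) (S : Finset (Plaquette d L)) :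
    Continuous fun U : GaugeConfig d L G => ∏ p ∈ S, w (plaquetteHolonomy U p.1 p.2.1.1 p.2.1.2) :=
  continuous_finsetProd S fun p _ => hw.comp (continuous_config_plaquetteHolonomy p.1 p.2.1.1 p.2.1.2)

omit [NeZero L] [TopologicalSpace G] [IsTopologicalGroup G] [CompactSpace G] [SecondCountableTopology G]
  [MeasurableSpace G] [BorelSpace G] in
/-- Squeezing: `m^{#S} ≤ ∏_{p∈S} w(U_p) ≤ M^{#S}` when `0 < m ≤ w ≤ M`. [folklore] -/
theorem pow_le_prodPlaquetteWeight_le_pow_anyDim {w : G → ℝ} {m M : ℝ} (hm0 : 0 < m) (hm : ∀ g, m ≤ w g)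
    (hM : ∀ g, w g ≤ M) (S : Finset (Plaquette d L)) (U : GaugeConfig d L G) :
    m ^ S.card ≤ ∏ p ∈ S, w (plaquetteHolonomy U p.1 p.2.1.1 p.2.1.2) ∧
      ∏ p ∈ S, w (plaquetteHolonomy U p.1 p.2.1.1 p.2.1.2) ≤ M ^ S.card := by
  constructor
  · rw [← Finset.prod_const]
    exact Finset.prod_le_prod (fun p _ => hm0.le) fun p _ => hm _
  · rw [← Finset.prod_const]
    exact Finset.prod_le_prod (fun p _ => (hm0.trans_le (hm _)).le) fun p _ => hM _

/-- A continuous positive bounded weight, normalised by its integral, is a probability density against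
the product Haar measure. [folklore] -/
theorem isProbabilityMeasure_haarPi_withDensity_div_integral_anyDim {F : GaugeConfig d L G → ℝ} (hFc : Continuous F)
    (hF0 : ∀ U, 0 < F U) {c K : ℝ} (hc0 : 0 < c) (hc : ∀ U, c ≤ F U) (hK : ∀ U, F U ≤ K) :
    IsProbabilityMeasure ((Measure.pi fun _ : Edge d L => haarProbability G).withDensity fun U =>
      ENNReal.ofReal (F U / ∫ V, F V ∂(Measure.pi fun _ : Edge d L => haarProbability G))) := by
  set Haar : Measure (GaugeConfig d L G) := Measure.pi fun _ : Edge d L => haarProbability G with hHaar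
  have hi : Integrable F Haar := by
    refine Integrable.mono' (integrable_const K) hFc.aestronglyMeasurable (ae_of_all _ fun U => ?_)
    rw [Real.norm_eq_abs, abs_of_pos (hF0 U)]; exact hK U
  have hZ : 0 < ∫ V, F V ∂Haar := by
    have h := integral_mono (integrable_const c) hi hc
    rw [integral_const, smul_eq_mul, probReal_univ, one_mul] at h
    exact hc0.trans_le h
  constructor
  rw [withDensity_apply _ MeasurableSet.univ, Measure.restrict_univ,
    ← ofReal_integral_eq_lintegral_ofReal (hi.div_const _)
      (ae_of_all _ fun U => div_nonneg (hF0 U).le hZ.le),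
    integral_div, div_self hZ.ne', ENNReal.ofReal_one]

/-! ## §2 The Doeblin law in every dimension -/

/-- **The plaquette-block–proposal exact sampler: Doeblin ⇒ `τ_int ≤ (M/m)^k − 1/2`
for EVERY bounded observable.**  `w` continuous with `0 < m ≤ w ≤ M`; `B` any set of base sites
(plaquettes) of `(ℤ/L)²`, `k = #(Bᶜ)`; `F_B = ∏_{p∈B} w(U_p)`, `F_R = ∏_{p∉B} w(U_p)`,
`F = ∏_{all p} w(U_p) = F_R·F_B` the full periodic weight; `π = (F/Z)·Haar^{⊗E}` the periodic target
and `q = (F_B/Z_B)·Haar^{⊗E}` — by `Scaling/AutoregressiveGaugeHeatBathExact2D` the LAW of the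
one-plaquette heat-bath autoregressive sampler when `B` is a free-boundary block (both ARE probability
measures: `isProbabilityMeasure_haarPi_withDensity_div_integral_anyDim`).  Then `q = ρ·π` with `ρ = Z/(Z_B·F_R)`,
`ρ(U) ≤ (M/m)^k ρ(V)`, and for the exact independence Metropolis kernel `K = indepMH q (1/ρ)`
(acceptance `min(1, F_R(V)/F_R(U))`, invariant law `π`): every bounded measurable `π`-centred
observable `f` has `|C_f(t)| ≤ (1 − (m/M)^k)^t ∫ f² dπ` for all `t` and `τ_int(f) ≤ (M/m)^k − 1/2`
(the scorers' `τ_int`). [ours] -/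
theorem plaquetteBlockProposal_autocorrelation {w : G → ℝ} (hw : Continuous w) {m M : ℝ} (hm0 : 0 < m)
    (hm : ∀ g, m ≤ w g) (hM : ∀ g, w g ≤ M) (B : Finset (Plaquette d L))
    (π q : Measure (GaugeConfig d L G)) [IsProbabilityMeasure π] [IsProbabilityMeasure q]
    (hπ : π = (Measure.pi fun _ : Edge d L => haarProbability G).withDensity fun U =>
      ENNReal.ofReal ((∏ p : Plaquette d L, w (plaquetteHolonomy U p.1 p.2.1.1 p.2.1.2)) /
        ∫ V, ∏ p : Plaquette d L, w (plaquetteHolonomy V p.1 p.2.1.1 p.2.1.2)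
          ∂(Measure.pi fun _ : Edge d L => haarProbability G)))
    (hq : q = (Measure.pi fun _ : Edge d L => haarProbability G).withDensity fun U =>
      ENNReal.ofReal ((∏ p ∈ B, w (plaquetteHolonomy U p.1 p.2.1.1 p.2.1.2)) /
        ∫ V, ∏ p ∈ B, w (plaquetteHolonomy V p.1 p.2.1.1 p.2.1.2)
          ∂(Measure.pi fun _ : Edge d L => haarProbability G)))
    {f : GaugeConfig d L G → ℝ} (hf : Measurable f) {C : ℝ} (hC : ∀ x, |f x| ≤ C)
    (hf0 : ∫ U, f U ∂π = 0) :
    (∀ t : ℕ, |autocov (indepMH q fun U =>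
        ((∫ V, ∏ p : Plaquette d L, w (plaquetteHolonomy V p.1 p.2.1.1 p.2.1.2)
            ∂(Measure.pi fun _ : Edge d L => haarProbability G)) /
          ((∫ V, ∏ p ∈ B, w (plaquetteHolonomy V p.1 p.2.1.1 p.2.1.2)
            ∂(Measure.pi fun _ : Edge d L => haarProbability G)) *
            ∏ p ∈ Finset.univ \ B, w (plaquetteHolonomy U p.1 p.2.1.1 p.2.1.2)))⁻¹) π f t|
        ≤ (1 - (m / M) ^ (Finset.univ \ B).card) ^ t * ∫ x, f x ^ 2 ∂π) ∧
      tauInt (fun t => autocov (indepMH q fun U =>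
        ((∫ V, ∏ p : Plaquette d L, w (plaquetteHolonomy V p.1 p.2.1.1 p.2.1.2)
            ∂(Measure.pi fun _ : Edge d L => haarProbability G)) /
          ((∫ V, ∏ p ∈ B, w (plaquetteHolonomy V p.1 p.2.1.1 p.2.1.2)
            ∂(Measure.pi fun _ : Edge d L => haarProbability G)) *
            ∏ p ∈ Finset.univ \ B, w (plaquetteHolonomy U p.1 p.2.1.1 p.2.1.2)))⁻¹) π f t /
          autocov (indepMH q fun U =>
        ((∫ V, ∏ p : Plaquette d L, w (plaquetteHolonomy V p.1 p.2.1.1 p.2.1.2)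
            ∂(Measure.pi fun _ : Edge d L => haarProbability G)) /
          ((∫ V, ∏ p ∈ B, w (plaquetteHolonomy V p.1 p.2.1.1 p.2.1.2)
            ∂(Measure.pi fun _ : Edge d L => haarProbability G)) *
            ∏ p ∈ Finset.univ \ B, w (plaquetteHolonomy U p.1 p.2.1.1 p.2.1.2)))⁻¹) π f 0) ≤
        (M / m) ^ (Finset.univ \ B).card - 1 / 2 := by
  set Haar : Measure (GaugeConfig d L G) := Measure.pi fun _ : Edge d L => haarProbability G with hHaar
  set FT : GaugeConfig d L G → ℝ := fun U => ∏ p : Plaquette d L, w (plaquetteHolonomy U p.1 p.2.1.1 p.2.1.2) with hFT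
  set FB : GaugeConfig d L G → ℝ := fun U => ∏ p ∈ B, w (plaquetteHolonomy U p.1 p.2.1.1 p.2.1.2) with hFB
  set FR : GaugeConfig d L G → ℝ := fun U => ∏ p ∈ Finset.univ \ B, w (plaquetteHolonomy U p.1 p.2.1.1 p.2.1.2)
    with hFR
  set ZT : ℝ := ∫ V, FT V ∂Haar with hZT
  set ZB : ℝ := ∫ V, FB V ∂Haar with hZB
  set k : ℕ := (Finset.univ \ B).card with hk
  have hw0 : ∀ g, 0 < w g := fun g => hm0.trans_le (hm g)
  have hMpos : 0 < M := (hw0 1).trans_le (hM 1)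
  haveI : IsProbabilityMeasure Haar := by rw [hHaar]; infer_instance
  have hFTc : Continuous FT := continuous_prodPlaquetteWeight_anyDim hw Finset.univ
  have hFBc : Continuous FB := continuous_prodPlaquetteWeight_anyDim hw B
  have hFRc : Continuous FR := continuous_prodPlaquetteWeight_anyDim hw (Finset.univ \ B)
  have hFTpos : ∀ U, 0 < FT U := fun U => prod_pos fun p _ => hw0 _
  have hFBpos : ∀ U, 0 < FB U := fun U => prod_pos fun p _ => hw0 _
  have hFRpos : ∀ U, 0 < FR U := fun U => prod_pos fun p _ => hw0 _
  have hFRge : ∀ U, m ^ k ≤ FR U := fun U => (pow_le_prodPlaquetteWeight_le_pow_anyDim hm0 hm hM _ U).1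
  have hFRle : ∀ U, FR U ≤ M ^ k := fun U => (pow_le_prodPlaquetteWeight_le_pow_anyDim hm0 hm hM _ U).2
  have hsplit : ∀ U, FT U = FR U * FB U := fun U => (Finset.prod_sdiff (Finset.subset_univ B)).symm
  have hint : ∀ {F : GaugeConfig d L G → ℝ}, Continuous F → (∀ U, 0 < F U) → ∀ K : ℝ, (∀ U, F U ≤ K) →
      Integrable F Haar := by
    intro F hF hF0 K hK
    refine Integrable.mono' (integrable_const K) hF.aestronglyMeasurable (ae_of_all _ fun U => ?_)
    rw [Real.norm_eq_abs, abs_of_pos (hF0 U)]; exact hK U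
  have hFTi : Integrable FT Haar :=
    hint hFTc hFTpos (M ^ (Finset.univ : Finset (Plaquette d L)).card)
      fun U => (pow_le_prodPlaquetteWeight_le_pow_anyDim hm0 hm hM _ U).2
  have hFBi : Integrable FB Haar :=
    hint hFBc hFBpos (M ^ B.card) fun U => (pow_le_prodPlaquetteWeight_le_pow_anyDim hm0 hm hM _ U).2
  have hZge : ∀ {F : GaugeConfig d L G → ℝ}, Integrable F Haar → ∀ c : ℝ, (∀ U, c ≤ F U) →
      c ≤ ∫ V, F V ∂Haar := by
    intro F hFi c hc
    have h := integral_mono (integrable_const c) hFi hc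
    rwa [integral_const, smul_eq_mul, probReal_univ, one_mul] at h
  have hZTpos : 0 < ZT :=
    lt_of_lt_of_le (pow_pos hm0 _) (hZge hFTi (m ^ (Finset.univ : Finset (Plaquette d L)).card)
      fun U => (pow_le_prodPlaquetteWeight_le_pow_anyDim hm0 hm hM _ U).1)
  have hZBpos : 0 < ZB :=
    lt_of_lt_of_le (pow_pos hm0 _) (hZge hFBi (m ^ B.card) fun U => (pow_le_prodPlaquetteWeight_le_pow_anyDim hm0 hm hM _ U).1)
  -- the density ratio `ρ = Z_T/(Z_B F_R)` : `q = ρ · π`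
  set ρ : GaugeConfig d L G → ℝ := fun U => ZT / (ZB * FR U) with hρ
  have hρpos : ∀ U, 0 < ρ U := fun U => div_pos hZTpos (mul_pos hZBpos (hFRpos U))
  have hρm : Measurable ρ := (continuous_const.div (continuous_const.mul hFRc)
    fun U => (mul_pos hZBpos (hFRpos U)).ne').measurable
  have hρq : q = π.withDensity fun U => ENNReal.ofReal (ρ U) := by
    rw [hq, hπ]
    change Haar.withDensity (fun U => ENNReal.ofReal (FB U / ZB)) =
      (Haar.withDensity fun U => ENNReal.ofReal (FT U / ZT)).withDensity fun U => ENNReal.ofReal (ρ U)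
    rw [← withDensity_mul _ (by fun_prop : Measurable fun U => ENNReal.ofReal (FT U / ZT))
      (by exact hρm.ennreal_ofReal)]
    refine withDensity_congr_ae (ae_of_all _ fun U => ?_)
    simp only [Pi.mul_apply]
    rw [← ENNReal.ofReal_mul (div_nonneg (hFTpos U).le hZTpos.le)]
    congr 1
    rw [hρ, hsplit U]
    field_simp [(hFRpos U).ne', hZBpos.ne', hZTpos.ne']
  -- the oscillation bound `ρ U ≤ (M/m)^k ρ V`
  have hmM : 0 < M / m := div_pos hMpos hm0
  have hosc : ∀ U V, ρ U ≤ Real.exp (k * Real.log (M / m)) * ρ V := by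
    intro U V
    rw [Real.exp_nat_mul, Real.exp_log hmM]
    have hm0' : m ≠ 0 := hm0.ne'
    have hM0' : M ≠ 0 := hMpos.ne'
    calc ρ U = ZT / (ZB * FR U) := rfl
      _ ≤ ZT / (ZB * m ^ k) :=
          div_le_div_of_nonneg_left hZTpos.le (mul_pos hZBpos (pow_pos hm0 k))
            (mul_le_mul_of_nonneg_left (hFRge U) hZBpos.le)
      _ = (M / m) ^ k * (ZT / (ZB * M ^ k)) := by
          rw [div_pow]; field_simp
      _ ≤ (M / m) ^ k * (ZT / (ZB * FR V)) :=
          mul_le_mul_of_nonneg_left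
            (div_le_div_of_nonneg_left hZTpos.le (mul_pos hZBpos (hFRpos V))
              (mul_le_mul_of_nonneg_left (hFRle V) hZBpos.le)) (pow_nonneg hmM.le k)
      _ = (M / m) ^ k * ρ V := rfl
  have hmain := indepMH_autocorrelation_of_density_ratio (π := π) (q := q) hρm hρpos hρq hosc hf hC hf0
  obtain ⟨hcov, htau, -⟩ := hmain
  have hexp : Real.exp (k * Real.log (M / m)) = (M / m) ^ k := by
    rw [Real.exp_nat_mul, Real.exp_log hmM]
  have hexpneg : Real.exp (-(k * Real.log (M / m))) = (m / M) ^ k := by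
    rw [Real.exp_neg, hexp, ← inv_pow, inv_div]
  refine ⟨fun t => ?_, ?_⟩
  · have h := hcov t
    rwa [hexpneg] at h
  · rwa [hexp] at htau


/-! ## §3 Pointwise acceptance -/

omit [TopologicalSpace G] [IsTopologicalGroup G] [CompactSpace G] [SecondCountableTopology G]
  [MeasurableSpace G] [BorelSpace G] in
/-- **Acceptance `≥ (m/M)^k` for every state and proposal.**  `0 < m ≤ w ≤ M`, any `B`, any `Z_B > 0`:
the Metropolis–Hastings acceptance of the independence proposal with density `F_B/Z_B` against the full
weight `F = ∏_{all p} w(U_p)` is `min(1, F_R(V)/F_R(U)) ≥ (m/M)^{#Bᶜ}`. [ours] -/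
theorem plaquetteBlockProposal_imhAcceptQ_ge {w : G → ℝ} {m M : ℝ} (hm0 : 0 < m)
    (hm : ∀ g, m ≤ w g) (hM : ∀ g, w g ≤ M) (B : Finset (Plaquette d L)) {Z : ℝ} (hZ : 0 < Z)
    (U V : GaugeConfig d L G) :
    (m / M) ^ (Finset.univ \ B).card ≤
      imhAcceptQ (fun U : GaugeConfig d L G => ∏ p : Plaquette d L, w (plaquetteHolonomy U p.1 p.2.1.1 p.2.1.2))
        (fun U : GaugeConfig d L G => (∏ p ∈ B, w (plaquetteHolonomy U p.1 p.2.1.1 p.2.1.2)) / Z) U V := by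
  have hw0 : ∀ g, 0 < w g := fun g => hm0.trans_le (hm g)
  have hMpos : 0 < M := (hw0 1).trans_le (hM 1)
  set FB : GaugeConfig d L G → ℝ := fun U => ∏ p ∈ B, w (plaquetteHolonomy U p.1 p.2.1.1 p.2.1.2) with hFB
  set FR : GaugeConfig d L G → ℝ := fun U => ∏ p ∈ Finset.univ \ B, w (plaquetteHolonomy U p.1 p.2.1.1 p.2.1.2)
    with hFR
  have hsplit : ∀ U, (∏ p : Plaquette d L, w (plaquetteHolonomy U p.1 p.2.1.1 p.2.1.2)) = FR U * FB U :=
    fun U => (Finset.prod_sdiff (Finset.subset_univ B)).symm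
  have hFBpos : ∀ U, 0 < FB U := fun U => prod_pos fun p _ => hw0 _
  have hFRpos : ∀ U, 0 < FR U := fun U => prod_pos fun p _ => hw0 _
  have hFRge : ∀ U, m ^ (Finset.univ \ B).card ≤ FR U := fun U =>
    (pow_le_prodPlaquetteWeight_le_pow_anyDim hm0 hm hM _ U).1
  have hFRle : ∀ U, FR U ≤ M ^ (Finset.univ \ B).card := fun U =>
    (pow_le_prodPlaquetteWeight_le_pow_anyDim hm0 hm hM _ U).2
  unfold imhAcceptQ
  beta_reduce
  rw [hsplit U, hsplit V]
  have hratio : FR V * FB V * (FB U / Z) / (FR U * FB U * (FB V / Z)) = FR V / FR U := by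
    field_simp [(hFBpos U).ne', (hFBpos V).ne', (hFRpos U).ne', hZ.ne']
  rw [hratio]
  refine le_min ?_ ?_
  · rw [div_pow]
    exact div_le_one_of_le₀ (pow_le_pow_left₀ hm0.le (by
      have := hm 1; have := hM 1; linarith) _) (pow_nonneg hMpos.le _)
  · rw [div_pow, div_le_div_iff₀ (pow_pos hMpos _) (hFRpos U)]
    calc m ^ (Finset.univ \ B).card * FR U ≤ m ^ (Finset.univ \ B).card * M ^ (Finset.univ \ B).card :=
          mul_le_mul_of_nonneg_left (hFRle U) (pow_nonneg hm0.le _)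
      _ = M ^ (Finset.univ \ B).card * m ^ (Finset.univ \ B).card := mul_comm _ _
      _ ≤ FR V * M ^ (Finset.univ \ B).card := by
          rw [mul_comm (FR V)]
          exact mul_le_mul_of_nonneg_left (hFRge V) (pow_nonneg hMpos.le _)

/-- **The same acceptance floor for the heat-bath autoregressive hybrid of a RANKED collection** (`L ≥ 2`,
`w` continuous with `0 < m ≤ w ≤ M`, `t`/`rank` as in `ranked_arHybrid_eq_target`, `l` any duplicate-free
list of all links): `imhAcceptQ F H_l U V ≥ (m/M)^{#Bᶜ}` — the exact sampler along a compatible order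
proposes, the Metropolis step pays only the plaquettes outside `B`. [ours] -/
theorem ranked_imhAcceptQ_ge (hL : 2 ≤ L) {w : G → ℝ} (hw : Continuous w) {m M : ℝ} (hm0 : 0 < m)
    (hm : ∀ g, m ≤ w g) (hM : ∀ g, w g ≤ M) (B : Finset (Plaquette d L)) (t : Plaquette d L → Edge d L)
    (ht : ∀ p ∈ B, t p ∈ ({(p.1, p.2.1.1), (p.1.shift p.2.1.1, p.2.1.2),
        (p.1.shift p.2.1.2, p.2.1.1), (p.1, p.2.1.2)} : Finset (Edge d L)))
    (rank : Plaquette d L → ℕ)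
    (hrank : ∀ p ∈ B, ∀ p' ∈ B, p ≠ p' → t p ∈ ({(p'.1, p'.2.1.1), (p'.1.shift p'.2.1.1, p'.2.1.2),
        (p'.1.shift p'.2.1.2, p'.2.1.1), (p'.1, p'.2.1.2)} : Finset (Edge d L)) → rank p < rank p')
    (l : List (Edge d L)) (hl : l.Nodup) (hall : ∀ e : Edge d L, e ∈ l) (U V : GaugeConfig d L G) :
    (m / M) ^ (Finset.univ \ B).card ≤
      imhAcceptQ (fun U : GaugeConfig d L G => ∏ p : Plaquette d L, w (plaquetteHolonomy U p.1 p.2.1.1 p.2.1.2))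
        (fun U : GaugeConfig d L G => (l.map fun b => ∏ p ∈ B.filter (fun p' => t p' = b),
            w (plaquetteHolonomy U p.1 p.2.1.1 p.2.1.2) / (∫ g, w g ∂(haarProbability G))).prod *
          coordAvg (haarProbability G) l.toFinset
            (fun V : GaugeConfig d L G => ∏ p ∈ B, w (plaquetteHolonomy V p.1 p.2.1.1 p.2.1.2)) U /
          (∫ V, ∏ p ∈ B, w (plaquetteHolonomy V p.1 p.2.1.1 p.2.1.2)
            ∂(Measure.pi fun _ : Edge d L => haarProbability G))) U V := by
  have hw0 : ∀ g, 0 < w g := fun g => hm0.trans_le (hm g)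
  have hc : 0 < ∫ g, w g ∂(haarProbability G) := haarProbability_integral_pos_of_continuous_pos hw hw0
  have hZ : 0 < ∫ V, ∏ p ∈ B, w (plaquetteHolonomy V p.1 p.2.1.1 p.2.1.2)
      ∂(Measure.pi fun _ : Edge d L => haarProbability G) := by
    rw [integral_prod_weight_eq_pow_of_rank (G := G) hL hw hm0 hm hM B t ht rank hrank]; exact pow_pos hc _
  have h := plaquetteBlockProposal_imhAcceptQ_ge (G := G) (L := L) hm0 hm hM B hZ U V
  unfold imhAcceptQ at h ⊢
  beta_reduce at h ⊢
  rw [ranked_arHybrid_eq_target (G := G) hL hw hm0 hm hM B t ht rank hrank l hl hall U,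
    ranked_arHybrid_eq_target (G := G) hL hw hm0 hm hM B t ht rank hrank l hl hall V]
  exact h

end Summit.Ventures.LatticeQCDFlow.Theory2.Autoregressive

end
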